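import Summits.QuantumFields.YangMills.Theorems.PoincareLipschitzConeLinkCutoff
import Summits.QuantumFields.YangMills.Theorems.PoincareLipschitzConeLinkChartIntegral
import Literature.Analysis.FunctionSpaces.DistributionalConstancy
import HarnessLib

/-!
# Crux `BlockLipschitzL` (stmt-QuantumFields-23533) ∕ `HistoryTailL` (stmt-QuantumFields-19936), LINE 25 «CompactnessTransfer»,
# the (TM) road, ROAD (H) «SU(2) CURRENTS ⇒ H-SYSTEM ⇒ 8π QUANTUM» — brick (T), row D-CL «THE SPHERE CURRENTS THROUGH THE CONE CHART»

Cell `ym3-torus` (YM ladder rung R3 = continuum SU(2) Yang–Mills on T³ — a RUNG, NOT Clay: not d = 4, not infinite volume,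
not a mass gap); WIDTH helper seat `ym3-torus-px19` g8, row D-CL of brick (T) (pen px14 g7, «px19: GO (T-4) = D-CL» 16:57:59Z;
letters FROZEN in `LETTERS-D-rows.px14g7.txt` 6d45db5d720dd832); `--supports stmt-QuantumFields-23533`; THEOREMS ONLY (0 `def`,
0 `sorry`, default heartbeats); imports px14∕px16's ✓A1 `…ConeLinkChart` (σ, c, conformality, ★★`sum_inner_apply_single_eq_frame`),
✓A2 `…ConeLinkChartRegion` (π), ✓A3 `…ConeLinkChartIntegral` (★★★ change of variables `setIntegral_ball_eq_integral_chart`),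
✓D1 `…ConeLinkCutoff` (the cone cut-off `ζ = V.indicator (χ(‖x‖) η(πx))` is a test function; `Dζ_{tσy}(t Dσ_y v) = χ(t) ∂_vη(y)`),
lit ✓`DistributionalConstancy` (a bump `χ` with `∫χ = 1` on a prescribed interval).

WHAT THIS FILE PROVES.  ★★★ `currents_through_chart` — the (T-4) conjunct of px19 g8's DOOR-T (`DOOR-T-text.px19g8.txt`
d75a11c77055d928) VERBATIM: given the COMMON HYPOTHESIS BLOCK of the D-rows (the link `w`, `Gw` read off the cone
`q ↦ q.1 • σ q.2` on the slab `S = (0, 1∕4) × E²`: `U ∘ Φ = w ∘ snd`, `(G ∘ Φ) ∘L (t • Dσ) = Gw ∘ snd`, `G_Φ(σ) = 0`, a.e. on `S`) and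
the 3-d sphere conservation laws `hlaw` (= w7 g14's ✓`weaklyHarmonic_of_cubeMinimiser` at `y = 0`, `ρ = 1∕2`, `ρ′ = 1∕4`, quantified
over orthonormal `p, q` and test `ζ` with `tsupport ζ ⊆ ball 0 (1∕4)`), the 2-d sphere conservation laws hold for `w`:
`∫ Σ_k ∂_kη · (⟪p, w⟫⟪Gw e_k, q⟫ − ⟪q, w⟫⟪Gw e_k, p⟫) = 0` for all orthonormal `p, q ∈ ℝ⁴` and all `η ∈ C_c^∞(E²)`.
PROOF.  Test `hlaw` with the cone cut-off `ζ := V.indicator (χ(‖x‖) η(πx))`, `tsupport χ ⊆ (1∕16, 1∕8)`, `∫χ = 1` (D1: a test function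
supported in `B̄_{1∕8} ⊆ B_{1∕4}`); shrink `B_{1∕2}` to `B_{1∕4}` (the integrand vanishes off `tsupport ζ`); change variables (A3);
on the slab the integrand is a trace form `Σ_i ⟪a e_i, b e_i⟫` with `a = Dζ_x`, `b =` the current functional, which the FRAME ROW (A1)
splits into the radial term (zero: `G_x(σ) = 0`) and the tangential terms (`a(Dσ e_k) = t⁻¹χ(t)∂_kη`, `b(Dσ e_k) = t⁻¹·`current of
`Gw e_k`), so `(t²c²) • integrand ∘ Φ = χ(t) · L(y)` a.e.; finally `∫_S χ ⊗ L = (∫χ)(∫L) = ∫L` (Mathlib `setIntegral_prod_mul`).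
HONEST SCOPE.  One row of brick (T); nothing of (GAP)∕(TM), S1″, K1, `MeanDeviationL`, `BlockLipschitzL`, `HistoryTailL` is
proved here.  YM₃ on T³ is rung R3, not Clay; YM gap NOT proved; no summit statement is proved here.

References: L. C. Evans, R. F. Gariepy (1992) [EvansGariepy1992] (§3.3.3 change of variables); F. Hélein (2002) [Helein2002] (§1.4
conservation laws; their conformal invariance in dimension 2).
-/

set_option autoImplicit false

noncomputable section

open MeasureTheory Set Function Filter Topology Metric
open scoped RealInnerProductSpace BigOperators ContDiff

namespace Summit.QuantumFields.YangMills.Theorems.PoincareLipschitzConeLinkCurrents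

open Literature.Analysis.FunctionSpaces (IsTestFunctionOn exists_contDiff_tsupport_subset_Ioo_integral_eq_one)
open Summit.QuantumFields.YangMills.Theorems.PoincareLipschitzConeLinkChart
open Summit.QuantumFields.YangMills.Theorems.PoincareLipschitzConeLinkCutoff

variable {c : EuclideanSpace ℝ (Fin 2) → ℝ} {σ : EuclideanSpace ℝ (Fin 2) → EuclideanSpace ℝ (Fin 3)}
  {π : EuclideanSpace ℝ (Fin 3) → EuclideanSpace ℝ (Fin 2)}
  {U : EuclideanSpace ℝ (Fin 3) → EuclideanSpace ℝ (Fin 4)}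
  {G : EuclideanSpace ℝ (Fin 3) → (EuclideanSpace ℝ (Fin 3) →L[ℝ] EuclideanSpace ℝ (Fin 4))}
  {w : EuclideanSpace ℝ (Fin 2) → EuclideanSpace ℝ (Fin 4)}
  {Gw : EuclideanSpace ℝ (Fin 2) → (EuclideanSpace ℝ (Fin 2) →L[ℝ] EuclideanSpace ℝ (Fin 4))}

/-! ## §1 The pointwise trace form on the cone -/

/-- **The integrand of a conservation law is a trace form**: with `a := Dζ_x` and the current functional
`b := ⟪p, U x⟫ • ⟪q, G_x ·⟫ − ⟪q, U x⟫ • ⟪p, G_x ·⟫`, `Σ_i ∂_iζ (⟪p,U⟫⟪G e_i, q⟫ − ⟪q,U⟫⟪G e_i, p⟫) = Σ_i ⟪a e_i, b e_i⟫_ℝ`. [folklore] -/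
theorem integrand_eq_sum_inner (ζ : EuclideanSpace ℝ (Fin 3) → ℝ) (p q : EuclideanSpace ℝ (Fin 4))
    (x : EuclideanSpace ℝ (Fin 3)) :
    ∑ i : Fin 3, fderiv ℝ ζ x (EuclideanSpace.single i (1:ℝ)) *
        (⟪p, U x⟫ * ⟪G x (EuclideanSpace.single i (1:ℝ)), q⟫ - ⟪q, U x⟫ * ⟪G x (EuclideanSpace.single i (1:ℝ)), p⟫) =
      ∑ i : Fin 3, ⟪fderiv ℝ ζ x (EuclideanSpace.single i (1:ℝ)),
        (⟪p, U x⟫ • (innerSL ℝ q).comp (G x) - ⟪q, U x⟫ • (innerSL ℝ p).comp (G x)) (EuclideanSpace.single i (1:ℝ))⟫ := by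
  refine Finset.sum_congr rfl fun i _ => ?_
  simp only [RCLike.inner_apply, conj_trivial]
  simp [real_inner_comm q, real_inner_comm p, mul_comm]

/-- **The trace form along the cone** (frame row + the three slab identities): at a point `x = t • σ y` where `U x = w y`,
`G_x ∘L (t • Dσ_y) = Gw y` and `G_x (σ y) = 0`, for the standard cone cut-off `ζ` (so that `Dζ_x (t • Dσ_y v) = χ t · ∂_vη y`),
`(t² c(y)²) · Σ_i ∂_iζ (…) = χ t · Σ_k ∂_kη (⟪p,w⟫⟪Gw e_k, q⟫ − ⟪q,w⟫⟪Gw e_k, p⟫)`. [folklore] -/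
theorem chart_integrand_eq (hc : ∀ y, c y = 2 / (1 + ‖y‖ ^ 2))
    (hσ : ∀ y, σ y = !₂[c y * y 0, c y * y 1, c y - 1]) {ζ : EuclideanSpace ℝ (Fin 3) → ℝ} {χ : ℝ → ℝ}
    {η : EuclideanSpace ℝ (Fin 2) → ℝ} (p q : EuclideanSpace ℝ (Fin 4)) {t : ℝ} (ht : 0 < t) (y : EuclideanSpace ℝ (Fin 2))
    (hζ : ∀ v, fderiv ℝ ζ (t • σ y) (t • fderiv ℝ σ y v) = χ t * fderiv ℝ η y v)
    (hVw : U (t • σ y) = w y) (hHw : (G (t • σ y)).comp (t • fderiv ℝ σ y) = Gw y)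
    (hrad : G (t • σ y) (σ y) = 0) :
    (t ^ 2 * c y ^ 2) * ∑ i : Fin 3, fderiv ℝ ζ (t • σ y) (EuclideanSpace.single i (1:ℝ)) *
        (⟪p, U (t • σ y)⟫ * ⟪G (t • σ y) (EuclideanSpace.single i (1:ℝ)), q⟫ -
          ⟪q, U (t • σ y)⟫ * ⟪G (t • σ y) (EuclideanSpace.single i (1:ℝ)), p⟫) =
      χ t * ∑ k : Fin 2, fderiv ℝ η y (EuclideanSpace.single k (1:ℝ)) *
        (⟪p, w y⟫ * ⟪Gw y (EuclideanSpace.single k (1:ℝ)), q⟫ - ⟪q, w y⟫ * ⟪Gw y (EuclideanSpace.single k (1:ℝ)), p⟫) := by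
  have hc0 : c y ≠ 0 := (c_pos hc y).ne'
  have ht0 : t ≠ 0 := ht.ne'
  set a : EuclideanSpace ℝ (Fin 3) →L[ℝ] ℝ := fderiv ℝ ζ (t • σ y) with ha
  set b : EuclideanSpace ℝ (Fin 3) →L[ℝ] ℝ :=
    ⟪p, U (t • σ y)⟫ • (innerSL ℝ q).comp (G (t • σ y)) - ⟪q, U (t • σ y)⟫ • (innerSL ℝ p).comp (G (t • σ y)) with hb
  rw [integrand_eq_sum_inner, sum_inner_apply_single_eq_frame hc hσ y a b]
  -- the radial term vanishes
  have hbσ : b (σ y) = 0 := by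
    simp [hb, hrad]
  -- the tangential terms
  have haD : ∀ k : Fin 2, a (fderiv ℝ σ y (EuclideanSpace.single k (1:ℝ))) =
      t⁻¹ * (χ t * fderiv ℝ η y (EuclideanSpace.single k (1:ℝ))) := by
    intro k
    have h := hζ (EuclideanSpace.single k (1:ℝ))
    rw [map_smul, smul_eq_mul] at h
    rw [← h, ← mul_assoc, inv_mul_cancel₀ ht0, one_mul]
  have hbD : ∀ k : Fin 2, b (fderiv ℝ σ y (EuclideanSpace.single k (1:ℝ))) =
      t⁻¹ * (⟪p, w y⟫ * ⟪Gw y (EuclideanSpace.single k (1:ℝ)), q⟫ - ⟪q, w y⟫ * ⟪Gw y (EuclideanSpace.single k (1:ℝ)), p⟫) := by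
    intro k
    have hG : G (t • σ y) (fderiv ℝ σ y (EuclideanSpace.single k (1:ℝ))) = t⁻¹ • Gw y (EuclideanSpace.single k (1:ℝ)) := by
      rw [← hHw]
      simp [smul_smul, inv_mul_cancel₀ ht0]
    simp [hb, hG, hVw, real_inner_comm q, real_inner_comm p]
    ring
  simp only [hbσ, Fin.sum_univ_two, haD, hbD, RCLike.inner_apply, conj_trivial]
  field_simp
  ring

/-! ## §2 The sphere currents through the chart: the (T-4) conjunct of DOOR-T -/

/-- ★★★ **THE 2-d SPHERE CONSERVATION LAWS OF THE LINK** — the (T-4) conjunct of px19 g8's DOOR-T VERBATIM: under the common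
hypothesis block of the D-rows (link `w`, `Gw` read off the cone on the slab `(0, 1∕4) × E²`, radial derivative zero) and the 3-d
conservation laws `hlaw` of w7 g14's ✓`weaklyHarmonic_of_cubeMinimiser` (at `y = 0`, `ρ = 1∕2`, `ρ′ = 1∕4`), for all orthonormal
`p, q ∈ ℝ⁴` and all `η ∈ C_c^∞(E²)`: `∫ Σ_k ∂_kη (⟪p,w⟫⟪Gw e_k, q⟫ − ⟪q,w⟫⟪Gw e_k, p⟫) = 0`.
[cite: Helein2002, §1.4 (conservation laws; conformal invariance in dimension two); EvansGariepy1992, §3.3.3] -/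
theorem currents_through_chart (hc : ∀ y, c y = 2 / (1 + ‖y‖ ^ 2))
    (hσ : ∀ y, σ y = !₂[c y * y 0, c y * y 1, c y - 1])
    (hπ : ∀ x, π x = (‖x‖ + x 2)⁻¹ • !₂[x 0, x 1])
    (hVw : ∀ᵐ q ∂(volume.restrict (Ioo (0:ℝ) (1/4) ×ˢ (univ : Set (EuclideanSpace ℝ (Fin 2))))),
      U (q.1 • σ q.2) = w q.2)
    (hHw : ∀ᵐ q ∂(volume.restrict (Ioo (0:ℝ) (1/4) ×ˢ (univ : Set (EuclideanSpace ℝ (Fin 2))))),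
      (G (q.1 • σ q.2)).comp (q.1 • fderiv ℝ σ q.2) = Gw q.2)
    (hradS : ∀ᵐ q ∂(volume.restrict (Ioo (0:ℝ) (1/4) ×ˢ (univ : Set (EuclideanSpace ℝ (Fin 2))))),
      G (q.1 • σ q.2) (σ q.2) = 0)
    (hlaw : ∀ (p q : EuclideanSpace ℝ (Fin 4)), ‖p‖ = 1 → ‖q‖ = 1 → ⟪p, q⟫ = 0 →
      ∀ ζ : EuclideanSpace ℝ (Fin 3) → ℝ, ContDiff ℝ ∞ ζ → tsupport ζ ⊆ ball (0 : EuclideanSpace ℝ (Fin 3)) (1/4) →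
      ∫ x in ball (0 : EuclideanSpace ℝ (Fin 3)) (1/2), ∑ i : Fin 3, fderiv ℝ ζ x (EuclideanSpace.single i (1:ℝ)) *
        (⟪p, U x⟫ * ⟪G x (EuclideanSpace.single i (1:ℝ)), q⟫ - ⟪q, U x⟫ * ⟪G x (EuclideanSpace.single i (1:ℝ)), p⟫) = 0) :
    ∀ (p q : EuclideanSpace ℝ (Fin 4)), ‖p‖ = 1 → ‖q‖ = 1 → ⟪p, q⟫ = 0 →
      ∀ η : EuclideanSpace ℝ (Fin 2) → ℝ, ContDiff ℝ ∞ η → HasCompactSupport η →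
        ∫ y, ∑ k : Fin 2, fderiv ℝ η y (EuclideanSpace.single k (1:ℝ)) *
          (⟪p, w y⟫ * ⟪Gw y (EuclideanSpace.single k (1:ℝ)), q⟫ - ⟪q, w y⟫ * ⟪Gw y (EuclideanSpace.single k (1:ℝ)), p⟫) = 0 := by
  intro p q hp hq hpq η hη hηc
  -- the radial bump `χ`
  obtain ⟨χ, hχ, -, hχs, hχ1⟩ :=
    exists_contDiff_tsupport_subset_Ioo_integral_eq_one (a := (1:ℝ)/16) (b := 1/8) (by norm_num)
  have hχs' : tsupport χ ⊆ Icc ((1:ℝ)/16) (1/8) := hχs.trans Ioo_subset_Icc_self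
  -- the cone cut-off `ζ`
  set ζ : EuclideanSpace ℝ (Fin 3) → ℝ :=
    {x : EuclideanSpace ℝ (Fin 3) | 0 < ‖x‖ + x 2}.indicator (fun x => (χ ‖x‖ * η (π x)) • (1 : ℝ)) with hζdef
  have hζt : IsTestFunctionOn (⟨ball (0 : EuclideanSpace ℝ (Fin 3)) (1/4), isOpen_ball⟩ : TopologicalSpace.Opens _) ζ :=
    isTestFunctionOn_coneCutoff hπ hχ (by norm_num : (0:ℝ) < 1/16) hχs' hη hηc (g := fun _ => (1:ℝ)) contDiffOn_const
      (closedBall_subset_ball (by norm_num : (1:ℝ)/8 < 1/4))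
  have h0 := hlaw p q hp hq hpq ζ hζt.contDiff hζt.tsupport_subset
  -- the 3-d integrand and the 2-d integrand
  set F : EuclideanSpace ℝ (Fin 3) → ℝ := fun x => ∑ i : Fin 3, fderiv ℝ ζ x (EuclideanSpace.single i (1:ℝ)) *
    (⟪p, U x⟫ * ⟪G x (EuclideanSpace.single i (1:ℝ)), q⟫ - ⟪q, U x⟫ * ⟪G x (EuclideanSpace.single i (1:ℝ)), p⟫) with hF
  set L : EuclideanSpace ℝ (Fin 2) → ℝ := fun y => ∑ k : Fin 2, fderiv ℝ η y (EuclideanSpace.single k (1:ℝ)) *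
    (⟪p, w y⟫ * ⟪Gw y (EuclideanSpace.single k (1:ℝ)), q⟫ - ⟪q, w y⟫ * ⟪Gw y (EuclideanSpace.single k (1:ℝ)), p⟫) with hL
  -- (1) shrink `B_{1/2}` to `B_{1/4}`
  have h1 : ∫ x in ball (0 : EuclideanSpace ℝ (Fin 3)) (1/2), F x = ∫ x in ball (0 : EuclideanSpace ℝ (Fin 3)) (1/4), F x :=
    setIntegral_eq_of_subset_of_forall_sdiff_eq_zero measurableSet_ball (ball_subset_ball (by norm_num)) fun x hx => by
      have hx' : x ∉ tsupport ζ := fun h => hx.2 (hζt.tsupport_subset h)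
      simp [hF, fderiv_of_notMem_tsupport ℝ hx']
  -- (2) the change of variables
  have h2 := setIntegral_ball_eq_integral_chart hc hσ (1/4 : ℝ) F
  -- (3) the integrand on the slab, a.e.
  have h3 : ∀ᵐ z ∂(volume.restrict (Ioo (0:ℝ) (1/4) ×ˢ (univ : Set (EuclideanSpace ℝ (Fin 2))))),
      (z.1 ^ 2 * c z.2 ^ 2) • F (z.1 • σ z.2) = χ z.1 * L z.2 := by
    filter_upwards [hVw, hHw, hradS, ae_restrict_mem (measurableSet_Ioo.prod MeasurableSet.univ)] with z hV hH hr hz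
    have ht : 0 < z.1 := (Set.mem_prod.1 hz).1.1
    rw [smul_eq_mul]
    exact chart_integrand_eq hc hσ p q ht z.2
      (fun v => fderiv_coneCutoff_smul_sigma hc hσ hπ hχ (by norm_num : (0:ℝ) < 1/16) hχs' hη hηc ht z.2 v) hV hH hr
  -- (4) the product integral
  have h4 : ∫ z in Ioo (0:ℝ) (1/4) ×ˢ (univ : Set (EuclideanSpace ℝ (Fin 2))), χ z.1 * L z.2 =
      (∫ t in Ioo (0:ℝ) (1/4), χ t) * ∫ y, L y := by
    rw [Measure.volume_eq_prod, setIntegral_prod_mul, Measure.restrict_univ]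
  -- (5) `∫_{(0,1/4)} χ = 1`
  have h5 : ∫ t in Ioo (0:ℝ) (1/4), χ t = 1 := by
    rw [setIntegral_eq_integral_of_forall_compl_eq_zero fun t ht => ?_, hχ1]
    refine image_eq_zero_of_notMem_tsupport fun h => ht ?_
    have := hχs h
    exact ⟨this.1.trans' (by norm_num), this.2.trans (by norm_num)⟩
  -- assemble
  calc ∫ y, L y = (∫ t in Ioo (0:ℝ) (1/4), χ t) * ∫ y, L y := by rw [h5, one_mul]
    _ = ∫ z in Ioo (0:ℝ) (1/4) ×ˢ (univ : Set (EuclideanSpace ℝ (Fin 2))), χ z.1 * L z.2 := h4.symm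
    _ = ∫ z in Ioo (0:ℝ) (1/4) ×ˢ (univ : Set (EuclideanSpace ℝ (Fin 2))), (z.1 ^ 2 * c z.2 ^ 2) • F (z.1 • σ z.2) :=
        (integral_congr_ae h3).symm
    _ = ∫ x in ball (0 : EuclideanSpace ℝ (Fin 3)) (1/4), F x := h2.symm
    _ = ∫ x in ball (0 : EuclideanSpace ℝ (Fin 3)) (1/2), F x := h1.symm
    _ = 0 := h0

end Summit.QuantumFields.YangMills.Theorems.PoincareLipschitzConeLinkCurrents
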